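import Summits.CriticalPhenomena.CardyFormulaZ2.Theses.CardyBondTriangular
import Literature.Probability.Percolation.SmirnovTheoremProofs

/-!
# Route item `SeparatingDataToCardy` (stmt-CriticalPhenomena-4666) — the analytic half of
Bollobás–Riordan's proof, instantiated for bond-𝕋

Support item of route `CardyBondTriangular` (sub-problem `CardyFormulaZ2`): if, for every
conformal rectangle `R` with a Carleson datum `(a, b, c, d, ψ)`, there are two systems of
discrete separating data (`IsSeparatingData R (triangleTurn a b c) S f`, Bollobás–Riordan 2006,
Ch. 7 §7.2.6) sandwiching the crude bond-𝕋 crossing probability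
`P_R(δ/√3) = P[embDomainCrossing z Ω (δ/√3) A₀ A₂]` at points `z_δ → d'`, then bond-𝕋 satisfies
Cardy's formula for every conformal rectangle (`BondTriangularCardy`).

The proof is the model-agnostic analytic half of the tree's kernel-checked Bollobás–Riordan proof
of Smirnov's theorem, with `triDomainCrossingProb` replaced by an arbitrary sandwiched function:

* `tendsto_apply_one_of_isSeparatingData`: for separating data `(S, f)` and points
  `z_δ ∈ S_δ ∩ Ω`, `z_δ → d'`, one has `f_δ¹(z_δ) → |d - c|/|a - c|` — the McShane interpolants
  `g_δ = dataFamily S f ε` form a Smirnov family (`IsSeparatingData.isSmirnovFamily`), so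
  `g_δ¹(z_δ) →` Carleson's ratio by the Arzelà–Ascoli argument `IsSmirnovFamily.tendsto_apply_one`
  fed with the PROVED facts (M) `triangleIntegral_eq_zero_of_forall_lattice_holds` and (U)
  `smirnov_claim24_holds`, and `g_δ - f_δ = o(1)` on `S_δ` (`dataFamily_approx`);
* `tendsto_of_isSeparatingData_sandwich`: hence any function sandwiched between
  `f⁻_δ¹(z⁻_δ) - e(δ)` and `f⁺_δ¹(z⁺_δ) + e(δ)`, `e → 0`, tends to Carleson's ratio (squeeze);
* `hasCrossingLimit_of_separatingData_sandwich`: if the sandwiched function is `δ ↦ P(δ/√3)`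
  then `P` has crossing limit `cardyFunction` — reparametrise `δ ↦ √3 δ` (a self-map of
  `𝓝[>] 0`), pick a Carleson datum by (B) `exists_isCarlesonMap_holds` and identify the limit
  with `F(η)` by (C) `cardyFunction_crossRatio_eq_carlesonRatio_holds`
  (cf. `hasCrossingLimit_triDomainCrossingProb_of_carleson`);
* `separatingDataToCardy_proof`: the item, by specialising `P` to the bond-𝕋 crude crossing
  probability.
-/

noncomputable section

namespace Summit.CriticalPhenomena.CardyFormulaZ2.Theorems

open Set Filter Topology
open Literature.Probability.Percolation Literature.Probability.RandomPlanarGeometry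
open Literature.Probability.LatticeModels

/-- **`f_δ¹(z_δ) → |d - c| / |a - c|` along the separating data** (Bollobás–Riordan 2006, Ch. 7,
proof of Thm. 2, pp. 202–203, "`f²_δ(z_δ) = h²(φ(P₄)) + o(1)`", in the tree's indexing). Let
`(S, f)` be discrete separating data for the conformal rectangle `R` with root of unity
`triangleTurn a b c` of a Carleson datum `(a, b, c, d, ψ)`, and let `z_δ ∈ S_δ ∩ Ω` eventually,
`z_δ → d'` as `δ → 0⁺`. Then `f_δ¹(z_δ)` tends to Carleson's ratio. Proof: the interpolants
`g_δ = dataFamily S f ε` form a Smirnov family, so `g_δ¹(z_δ) →` Carleson's ratio by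
`IsSmirnovFamily.tendsto_apply_one` ((M) and (U) being proved in the tree), and
`g_δ¹(z_δ) - f_δ¹(z_δ) → 0` by `dataFamily_approx`. -/
theorem tendsto_apply_one_of_isSeparatingData {R : ConformalRectangle} {a b c d : ℂ}
    {ψ : ConformalEquiv R.carrier (openTriangle a b c)} (habc : IsEquilateral a b c)
    (hd : d ∈ openSegment ℝ c a) (hψ : IsCarlesonMap R a b c d ψ) {S : ℝ → Finset ℂ}
    {f : ℝ → Fin 3 → ℂ → ℝ} (hD : IsSeparatingData R (triangleTurn a b c) S f) {z : ℝ → ℂ}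
    (hzmem : ∀ᶠ δ in 𝓝[>] (0 : ℝ), z δ ∈ S δ ∧ z δ ∈ R.carrier)
    (hz : Tendsto z (𝓝[>] 0) (𝓝 (R.pt 3))) :
    Tendsto (fun δ => f δ 1 (z δ)) (𝓝[>] 0) (𝓝 (carlesonRatio a c d)) := by
  obtain ⟨ε, hε, hdense⟩ := hD.dense
  obtain ⟨δ₀, hδ₀, hgood⟩ := exists_forall_Ioo_of_eventually hzmem
  -- the interpolants form a Smirnov family, so `g_δ¹(z_δ) → |d - c| / |a - c|`
  have hg : Tendsto (fun δ => dataFamily S f ε δ 1 (z δ)) (𝓝[>] 0) (𝓝 (carlesonRatio a c d)) :=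
    (hD.isSmirnovFamily hε hdense δ₀).tendsto_apply_one
      triangleIntegral_eq_zero_of_forall_lattice_holds smirnov_claim24_holds hδ₀ habc hd hψ
      (fun δ hδ => (hgood δ hδ).2) hz
  -- `g_δ¹(z_δ) - f_δ¹(z_δ) → 0`
  have hdiff : Tendsto (fun δ => dataFamily S f ε δ 1 (z δ) - f δ 1 (z δ)) (𝓝[>] 0) (𝓝 0) := by
    rw [Metric.tendsto_nhds]
    intro η hη
    filter_upwards [dataFamily_approx hD hε (half_pos hη), hzmem] with δ happ hmem
    have h := happ 1 (z δ) hmem.1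
    rw [Real.dist_0_eq_abs, abs_lt]
    constructor <;> linarith [h.1, h.2]
  have h := hg.sub hdiff
  rw [sub_zero] at h
  refine h.congr fun δ => ?_
  ring

/-- **The squeeze** (Bollobás–Riordan 2006, Ch. 7, proof of Thm. 2, p. 203, with the sandwich
(19)/(40)): if two systems of separating data `(S⁻, f⁻)`, `(S⁺, f⁺)` for `R` and the Carleson
datum `(a, b, c, d, ψ)` sandwich a function `Q`,
`f⁻_δ¹(z⁻_δ) - e(δ) ≤ Q(δ) ≤ f⁺_δ¹(z⁺_δ) + e(δ)` eventually, with `z∓_δ ∈ S∓_δ ∩ Ω` tending to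
`d'` and `e(δ) → 0`, then `Q(δ) → |d - c| / |a - c|` as `δ → 0⁺`. -/
theorem tendsto_of_isSeparatingData_sandwich {R : ConformalRectangle} {a b c d : ℂ}
    {ψ : ConformalEquiv R.carrier (openTriangle a b c)} (habc : IsEquilateral a b c)
    (hd : d ∈ openSegment ℝ c a) (hψ : IsCarlesonMap R a b c d ψ) {Sm Sp : ℝ → Finset ℂ}
    {fm fp : ℝ → Fin 3 → ℂ → ℝ} (hDm : IsSeparatingData R (triangleTurn a b c) Sm fm)
    (hDp : IsSeparatingData R (triangleTurn a b c) Sp fp) {zm zp : ℝ → ℂ} {e Q : ℝ → ℝ}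
    (hmem : ∀ᶠ δ in 𝓝[>] (0 : ℝ), zm δ ∈ Sm δ ∧ zm δ ∈ R.carrier ∧ zp δ ∈ Sp δ ∧ zp δ ∈ R.carrier)
    (hzm : Tendsto zm (𝓝[>] 0) (𝓝 (R.pt 3))) (hzp : Tendsto zp (𝓝[>] 0) (𝓝 (R.pt 3)))
    (he : Tendsto e (𝓝[>] 0) (𝓝 0))
    (hsand : ∀ᶠ δ in 𝓝[>] (0 : ℝ), fm δ 1 (zm δ) - e δ ≤ Q δ ∧ Q δ ≤ fp δ 1 (zp δ) + e δ) :
    Tendsto Q (𝓝[>] 0) (𝓝 (carlesonRatio a c d)) := by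
  have h1 := tendsto_apply_one_of_isSeparatingData habc hd hψ hDm
    (hmem.mono fun δ hδ => ⟨hδ.1, hδ.2.1⟩) hzm
  have h2 := tendsto_apply_one_of_isSeparatingData habc hd hψ hDp
    (hmem.mono fun δ hδ => ⟨hδ.2.2.1, hδ.2.2.2⟩) hzp
  have hlow : Tendsto (fun δ => fm δ 1 (zm δ) - e δ) (𝓝[>] 0) (𝓝 (carlesonRatio a c d)) := by
    simpa using h1.sub he
  have hup : Tendsto (fun δ => fp δ 1 (zp δ) + e δ) (𝓝[>] 0) (𝓝 (carlesonRatio a c d)) := by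
    simpa using h2.add he
  exact tendsto_of_tendsto_of_tendsto_of_le_of_le' hlow hup (hsand.mono fun δ hδ => hδ.1)
    (hsand.mono fun δ hδ => hδ.2)

/-- The reparametrisation `δ ↦ √3 δ` maps `𝓝[>] 0` to itself. [folklore] -/
theorem tendsto_sqrt_three_mul_nhdsGT :
    Tendsto (fun δ : ℝ => Real.sqrt 3 * δ) (𝓝[>] 0) (𝓝[>] 0) := by
  refine tendsto_nhdsWithin_iff.2 ⟨?_, ?_⟩
  · have h : Tendsto (fun δ : ℝ => Real.sqrt 3 * δ) (𝓝 0) (𝓝 (Real.sqrt 3 * 0)) :=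
      tendsto_id.const_mul _
    rw [mul_zero] at h
    exact h.mono_left nhdsWithin_le_nhds
  · filter_upwards [self_mem_nhdsWithin] with δ hδ
    exact mul_pos (Real.sqrt_pos.2 (by norm_num)) hδ

/-- **Cardy's formula from separating data sandwiching `P(δ/√3)`** (the analytic half of
Bollobás–Riordan 2006, Ch. 7, proof of Thm. 2, pp. 196–203, for an arbitrary crossing-probability
function `P` of the conformal rectangle `R`). If for every Carleson datum `(a, b, c, d, ψ)` of `R`
there are two systems of discrete separating data sandwiching `δ ↦ P(δ/√3)` at points tending to
`d'`, then `R` has crossing limit `cardyFunction` for `P`: by the squeeze `P(δ/√3) →` Carleson's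
ratio, hence `P(δ) →` Carleson's ratio (reparametrise `δ ↦ √3 δ`), and for every uniformizing
datum `(φ, x)` Carleson's ratio of the datum given by (B) `exists_isCarlesonMap_holds` is
`F(η(x))` by (C) `cardyFunction_crossRatio_eq_carlesonRatio_holds`. -/
theorem hasCrossingLimit_of_separatingData_sandwich (R : ConformalRectangle) (P : ℝ → ℝ)
    (h : ∀ (a b c d : ℂ) (ψ : ConformalEquiv R.carrier (openTriangle a b c)),
      IsEquilateral a b c → d ∈ openSegment ℝ c a → IsCarlesonMap R a b c d ψ →
        ∃ (Sm Sp : ℝ → Finset ℂ) (fm fp : ℝ → Fin 3 → ℂ → ℝ),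
          IsSeparatingData R (triangleTurn a b c) Sm fm ∧
            IsSeparatingData R (triangleTurn a b c) Sp fp ∧
            ∃ (zm zp : ℝ → ℂ) (e : ℝ → ℝ),
              (∀ᶠ δ in 𝓝[>] (0 : ℝ),
                  zm δ ∈ Sm δ ∧ zm δ ∈ R.carrier ∧ zp δ ∈ Sp δ ∧ zp δ ∈ R.carrier) ∧
                Tendsto zm (𝓝[>] 0) (𝓝 (R.pt 3)) ∧ Tendsto zp (𝓝[>] 0) (𝓝 (R.pt 3)) ∧
                  Tendsto e (𝓝[>] 0) (𝓝 0) ∧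
                    ∀ᶠ δ in 𝓝[>] (0 : ℝ), fm δ 1 (zm δ) - e δ ≤ P (δ / Real.sqrt 3) ∧
                      P (δ / Real.sqrt 3) ≤ fp δ 1 (zp δ) + e δ) :
    R.HasCrossingLimit P Literature.Probability.RandomPlanarGeometry.cardyFunction := by
  intro φ x hφ
  obtain ⟨a, b, c, d, ψ, habc, hd, hψ⟩ := exists_isCarlesonMap_holds R
  rw [cardyFunction_crossRatio_eq_carlesonRatio_holds R a b c d ψ φ x habc hd hψ hφ]
  obtain ⟨Sm, Sp, fm, fp, hDm, hDp, zm, zp, e, hmem, hzm, hzp, he, hsand⟩ :=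
    h a b c d ψ habc hd hψ
  have hQ : Tendsto (fun δ => P (δ / Real.sqrt 3)) (𝓝[>] 0) (𝓝 (carlesonRatio a c d)) :=
    tendsto_of_isSeparatingData_sandwich habc hd hψ hDm hDp hmem hzm hzp he hsand
  have hne : Real.sqrt 3 ≠ 0 := (Real.sqrt_pos.2 (by norm_num)).ne'
  refine (hQ.comp tendsto_sqrt_three_mul_nhdsGT).congr fun δ => ?_
  simp only [Function.comp_apply, mul_div_cancel_left₀ δ hne]

/-- **Route item `SeparatingDataToCardy` (stmt-CriticalPhenomena-4666).** The analytic half of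
Bollobás–Riordan's proof of Smirnov's theorem (Percolation, CUP 2006, Ch. 7 §7.2.6, proof of
Thm. 2 pp. 202–203), instantiated for canonical bond percolation on the triangular lattice `𝕋`
(edge weight `criticalWeightI (π/6)`, embedding `z x = √3 (triEmbed x − (1+ζ)/3)`): if for every
conformal rectangle with a Carleson datum there are discrete separating data for an inner and an
outer approximation sandwiching the crude bond-𝕋 crossing probability at mesh `δ/√3`, then
bond-𝕋 satisfies Cardy's formula for every conformal rectangle (`BondTriangularCardy`).
Specialisation of `hasCrossingLimit_of_separatingData_sandwich`. -/
theorem separatingDataToCardy_proof :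
    Summit.CriticalPhenomena.CardyFormulaZ2.Theses.CardyBondTriangular.SeparatingDataToCardy := by
  unfold Summit.CriticalPhenomena.CardyFormulaZ2.Theses.CardyBondTriangular.SeparatingDataToCardy
  intro h R
  refine hasCrossingLimit_of_separatingData_sandwich R _ fun a b c d ψ habc hd hψ => ?_
  exact h R a b c d ψ habc hd hψ

end Summit.CriticalPhenomena.CardyFormulaZ2.Theorems

end
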